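import Summits.CriticalPhenomena.SAWScalingLimit.Theses.SAWCompassLattice
import Summits.CriticalPhenomena.SAWScalingLimit.Theses.SAWTrackTransport
import Summits.CriticalPhenomena.SAWScalingLimit.Theorems.SAWCompassLatticeCompassSLEIffYBSquareSLE
import Summits.CriticalPhenomena.SAWScalingLimit.Theorems.SAWCompassLatticeCompassSLEReduction
import Summits.CriticalPhenomena.SAWScalingLimit.Theorems.SAWCompassLatticeCompassSLEStubsNecessary
import Summits.CriticalPhenomena.SAWScalingLimit.Theorems.SAWCompassLatticeCompassSLEYbTightNecessity
import Summits.CriticalPhenomena.SAWScalingLimit.Theorems.SAWCompassLatticeCompassSLEYbRestrictionLawNecessity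
import Summits.CriticalPhenomena.SAWScalingLimit.Theorems.SAWCompassLatticeCompassSLEYbSimpleOfTrackTransport
import Summits.CriticalPhenomena.SAWScalingLimit.Theorems.SAWCompassLatticeCompassSLEYbCriterion
import Summits.CriticalPhenomena.SAWScalingLimit.Theorems.SAWDevelopingMapHexTransferAngleTransportOfTrackTransport
import Literature.Probability.RandomPlanarGeometry.SLEConvergenceCriterion
import Literature.Probability.RandomPlanarGeometry.LocalMartingaleProofs

/-!
# The crux `CompassSLE` is EXACTLY the conjunction of its three open stubs, and it follows from the
# cruxes of route SAWTrackTransport (crux stmt-CriticalPhenomena-6965, line `registered`, lead c2)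

Capstone of the registered skeleton `Cruxes/CompassSLE/Lines/birth.lean` (v4/v5). Its three open stubs
T1 `stub_ybTraversalBound` (Aizenman–Burchard traversal bound, shell-dependent threshold), I1
`stub_ybRestrictionLaw` (Lawler–Schramm–Werner `5/8` restriction law) and I2b `stub_ybSubseqLimitSimple`
(simplicity of probability subsequential limits), all for Glazman–Manolescu's critical `π/2`
Yang–Baxter walk, are each an open problem. This file records, sorry-free:

* `convergesInLawToSLE_yb_iff_tight_and_identification` — pointwise in `(D; a, b)` and for every `κ`:
  the `π/2` curve laws converge in law to chordal SLE_κ **iff** they are tight along the mesh AND every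
  probability subsequential limit law is an SLE_κ law (⇒: Le Cam along the mesh,
  `ybTight_of_convergesInLawToSLE`, and uniqueness of weak limits; ⇐: the criterion
  `convergesInLawToSLE_of_eventually_isProbabilityMeasure`).
* `ybSquareSLE_iff_tight_and_identification` — `YBSquareSLE ↔ T ∧ I` (the v1 split is exact).
* `compassSLE_iff_stubs` — **`CompassSLE ↔ T1 ∧ I1 ∧ I2b`** with the three registered stub
  statements verbatim (⇐: the landed reduction `compassSLE_of_traversalBound_restrictionLaw_simpleLimits`,
  p147227; ⇒: the landed certificates `ybTraversalBound_of_ybSquareSLE` p151290,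
  `ybRestrictionLaw_of_ybSquareSLE` p151765, `ybSubseqLimitSimple_of_ybSquareSLE` p145875, through
  `compassSLE_iff_ybSquareSLE` p143456). So promoting the stubs to items is LOSSLESS, and a refutation
  of any one of them refutes the crux and the route; `ybSquareSLE_iff_stubs` is the same for stmt-6967.
* `ybSquareSLE_of_trackTransport`, `compassSLE_of_trackTransport` — the crux follows from the five
  cruxes of the sibling route SAWTrackTransport (`AngleUniversality` stmt-16963, `YBLimitExists`
  stmt-16995, `AxiomsOfLimit` stmt-16965, `RStarRot` stmt-7298, `MirrorRotation` stmt-16997): port of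
  that route's deciding theorem minus `YBtoUniform` (robust full limit `P`, its axioms, rotation
  covariance by the reflection trick, conformal covariance by `R*_rot`, then the PROVED
  `LawlerSchrammWerner2003_holds` identifies `P D` as the SLE(8/3) law; the robust limit at `u ≡ 0`
  is convergence in law, `YbRelay.tendstoLaw_of_robustLimit`).

No named fact is used; axioms `propext`, `Classical.choice`, `Quot.sound`.
-/

noncomputable section

namespace Summit.CriticalPhenomena.SAWScalingLimit.Theorems.SAWCompassLatticeCompassSLE

open MeasureTheory Filter Topology Set
open scoped NNReal ENNReal BoundedContinuousFunction
open Literature.Probability Literature.Probability.RandomPlanarGeometry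
open Literature.Probability.RandomPlanarGeometry.SAW.YangBaxter
open UpperHalfPlane (upperHalfPlaneSet)
open Summit.CriticalPhenomena.SAWScalingLimit.Theses

/-! ### Pointwise structure: convergence ⇔ tightness ∧ identification -/

/-- **Convergence of GM's `π/2` walk to SLE_κ ⇔ tightness along the mesh ∧ identification of the
probability subsequential limit laws**, pointwise in the Dobrushin domain and the port endpoint
approximation, for every `κ`. (⇒) Le Cam along the mesh (`ybTight_of_convergesInLawToSLE`) and
uniqueness of weak limits of probability measures on `CurveClass ℂ`; (⇐) Prokhorov + uniqueness of the
SLE_κ law (`convergesInLawToSLE_of_eventually_isProbabilityMeasure`, the laws being probability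
measures eventually, `eventually_isProbabilityMeasure_ybLaw`). -/
theorem convergesInLawToSLE_yb_iff_tight_and_identification {κ : ℝ≥0} {D : DobrushinDomain}
    {a b : ℝ → MidEdge} (hab : IsYBEndpointApprox (fun (_ : ℤ) => Real.pi / 2) D a b) :
    ConvergesInLawToSLE κ D
        (fun δ (γ : YangBaxterSAW (fun (_ : ℤ) => Real.pi / 2) D.carrier δ (a δ) (b δ)) =>
          γ.curve (fun (_ : ℤ) => Real.pi / 2) δ)
        (fun δ => ybLaw (fun (_ : ℤ) => Real.pi / 2) D.carrier δ 1 (a δ) (b δ)) ↔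
      IsTightAlongMesh
          (fun δ (γ : YangBaxterSAW (fun (_ : ℤ) => Real.pi / 2) D.carrier δ (a δ) (b δ)) =>
            γ.curve (fun (_ : ℤ) => Real.pi / 2) δ)
          (fun δ => ybLaw (fun (_ : ℤ) => Real.pi / 2) D.carrier δ 1 (a δ) (b δ)) ∧
        ∀ μ : Measure (CurveClass ℂ), IsProbabilityMeasure μ →
          IsSubseqLimitLaw
            (fun δ (γ : YangBaxterSAW (fun (_ : ℤ) => Real.pi / 2) D.carrier δ (a δ) (b δ)) =>
              γ.curve (fun (_ : ℤ) => Real.pi / 2) δ)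
            (fun δ => ybLaw (fun (_ : ℤ) => Real.pi / 2) D.carrier δ 1 (a δ) (b δ)) μ →
          IsSLELaw κ D μ := by
  constructor
  · intro h
    refine ⟨ybTight_of_convergesInLawToSLE hab h, fun μ hμ hsub => ?_⟩
    obtain ⟨Γ, hΓ, -, hT⟩ := h
    obtain ⟨s, hs, hlim⟩ := hsub
    haveI := isProbabilityMeasure_preWienerMeasure'
    haveI : IsProbabilityMeasure (Process.preWienerMeasure.map Γ) :=
      Measure.isProbabilityMeasure_map hΓ.aemeasurable
    haveI := hμ
    have key : μ = Process.preWienerMeasure.map Γ := by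
      apply ext_of_forall_integral_eq_of_IsFiniteMeasure
      intro f
      rw [integral_map hΓ.aemeasurable f.continuous.aestronglyMeasurable]
      exact tendsto_nhds_unique (hlim f) ((hT f).comp hs)
    exact ⟨Γ, hΓ, key⟩
  · rintro ⟨hT, hI⟩
    exact convergesInLawToSLE_of_eventually_isProbabilityMeasure
      (eventually_isProbabilityMeasure_ybLaw D hab)
      (fun δ => YBWalk.aemeasurable_curve (fun (_ : ℤ) => Real.pi / 2) D.carrier δ 1 (a δ) (b δ)) hT hI

/-- **`YBSquareSLE ↔ T ∧ I`**: chordal SLE(8/3) convergence of GM's critical `π/2` Yang–Baxter walk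
(item stmt-CriticalPhenomena-6967) is EXACTLY tightness along the mesh (v1 stub T) plus identification
of the probability subsequential limit laws (v1 stub I), both for every Dobrushin domain and port
endpoint approximation. -/
theorem ybSquareSLE_iff_tight_and_identification :
    SAWCompassLattice.YBSquareSLE ↔
      (∀ (D : DobrushinDomain) (a b : ℝ → MidEdge),
        IsYBEndpointApprox (fun (_ : ℤ) => Real.pi / 2) D a b →
        IsTightAlongMesh
          (fun δ (γ : YangBaxterSAW (fun (_ : ℤ) => Real.pi / 2) D.carrier δ (a δ) (b δ)) =>
            γ.curve (fun (_ : ℤ) => Real.pi / 2) δ)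
          (fun δ => ybLaw (fun (_ : ℤ) => Real.pi / 2) D.carrier δ 1 (a δ) (b δ))) ∧
      (∀ (D : DobrushinDomain) (a b : ℝ → MidEdge),
        IsYBEndpointApprox (fun (_ : ℤ) => Real.pi / 2) D a b →
        ∀ μ : Measure (CurveClass ℂ), IsProbabilityMeasure μ →
          IsSubseqLimitLaw
            (fun δ (γ : YangBaxterSAW (fun (_ : ℤ) => Real.pi / 2) D.carrier δ (a δ) (b δ)) =>
              γ.curve (fun (_ : ℤ) => Real.pi / 2) δ)
            (fun δ => ybLaw (fun (_ : ℤ) => Real.pi / 2) D.carrier δ 1 (a δ) (b δ)) μ →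
          IsSLELaw ((8 : NNReal) / 3) D μ) := by
  constructor
  · intro h
    exact ⟨fun D a b hab => ((convergesInLawToSLE_yb_iff_tight_and_identification hab).1
        (h D a b hab)).1,
      fun D a b hab => ((convergesInLawToSLE_yb_iff_tight_and_identification hab).1
        (h D a b hab)).2⟩
  · rintro ⟨hT, hI⟩ D a b hab
    exact (convergesInLawToSLE_yb_iff_tight_and_identification hab).2 ⟨hT D a b hab, hI D a b hab⟩

/-! ### The crux is exactly the conjunction of its three open stubs -/

/-- **`YBSquareSLE ↔ T1 ∧ I1 ∧ I2b`** with the three registered open stubs of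
`Cruxes/CompassSLE/Lines/birth.lean` verbatim: the Aizenman–Burchard traversal bound (shell-dependent
threshold), the Lawler–Schramm–Werner `5/8` restriction law, and simplicity of the probability
subsequential limit laws, all for GM's critical `π/2` walk. (⇐) the landed reduction through T2, C,
I2a, I3 and the port transfer; (⇒) the landed necessity certificates (Le Cam along the mesh;
portmanteau sandwich with the SLE(8/3)-null touching event; Rohde–Schramm simplicity of the SLE(8/3)
carrier). Hence promoting the stubs to items loses nothing, and refuting any one refutes the item.
[cite: LawlerSchrammWerner2003Restriction, Thm. 6.1 (p. 23)] -/
theorem ybSquareSLE_iff_stubs :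
    SAWCompassLattice.YBSquareSLE ↔
      ((∀ (D : DobrushinDomain) (a b : ℝ → MidEdge),
        IsYBEndpointApprox (fun (_ : ℤ) => Real.pi / 2) D a b →
        ∃ (k : ℂ → ℝ → ℝ → ℕ) (K lam δ₀ : ℝ), 0 ≤ K ∧ 2 < lam ∧ 0 < δ₀ ∧
          ∀ δ ∈ Set.Ioc (0 : ℝ) δ₀, ∀ (x : ℂ) (ρ R : ℝ), δ ≤ ρ → ρ < R → R ≤ 1 →
            ybLaw (fun (_ : ℤ) => Real.pi / 2) D.carrier δ 1 (a δ) (b δ)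
                {γ | (⟨γ.path (fun (_ : ℤ) => Real.pi / 2) δ⟩ : Curve ℂ).HasTraversals (k x ρ R) x ρ R} ≤
              ENNReal.ofReal (K * (ρ / R) ^ lam)) ∧
      (∀ (D D' : DobrushinDomain) (a b : ℝ → MidEdge),
        IsYBEndpointApprox (fun (_ : ℤ) => Real.pi / 2) D a b →
        D'.carrier ⊆ D.carrier → D'.pt 0 = D.pt 0 → D'.pt 1 = D.pt 1 →
        (∃ ε : ℝ, 0 < ε ∧ D'.carrier ∩ Metric.ball (D.pt 0) ε = D.carrier ∩ Metric.ball (D.pt 0) ε ∧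
          D'.carrier ∩ Metric.ball (D.pt 1) ε = D.carrier ∩ Metric.ball (D.pt 1) ε) →
        ∀ (φ : ConformalEquiv upperHalfPlaneSet D.carrier), D.IsChordalUniformizing φ →
        ∀ (Φ : ConformalEquiv (upperHalfPlaneSet \ φ.pullbackHull D') upperHalfPlaneSet) (d : ℝ),
          IsRestrictionMap (φ.pullbackHull D') Φ → HasRestrictionDeriv (φ.pullbackHull D') Φ d →
          Tendsto (fun δ => ((ybLaw (fun (_ : ℤ) => Real.pi / 2) D.carrier δ 1 (a δ) (b δ)).map
              (fun γ => γ.curve (fun (_ : ℤ) => Real.pi / 2) δ))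
              (CurveClass.rangeSubset (closure D'.carrier)))
            (𝓝[>] (0 : ℝ)) (𝓝 (ENNReal.ofReal (d ^ ((5 : ℝ) / 8))))) ∧
      (∀ (D : DobrushinDomain) (a b : ℝ → MidEdge),
        IsYBEndpointApprox (fun (_ : ℤ) => Real.pi / 2) D a b →
        ∀ (s : ℕ → ℝ) (ν : Measure (CurveClass ℂ)), Tendsto s atTop (𝓝[>] (0 : ℝ)) →
          IsProbabilityMeasure ν →
          (∀ f : BoundedContinuousFunction (CurveClass ℂ) ℝ,
            Tendsto (fun n => ∫ γ, f (γ.curve (fun (_ : ℤ) => Real.pi / 2) (s n))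
                ∂(ybLaw (fun (_ : ℤ) => Real.pi / 2) D.carrier (s n) 1 (a (s n)) (b (s n))))
              atTop (𝓝 (∫ x, f x ∂ν))) →
          ∀ᵐ γ ∂ν, γ ∈ CurveClass.simple)) :=
  ⟨fun hY => ⟨ybTraversalBound_of_ybSquareSLE hY, ybRestrictionLaw_of_ybSquareSLE hY,
      ybSubseqLimitSimple_of_ybSquareSLE hY⟩,
    fun h => ybSquareSLE_of_compassSLE
      (compassSLE_of_traversalBound_restrictionLaw_simpleLimits h.1 h.2.1 h.2.2)⟩

/-- **`CompassSLE ↔ T1 ∧ I1 ∧ I2b`**: the crux stmt-CriticalPhenomena-6965 (chordal SLE(8/3)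
convergence of the honest edge-fugacity SAW on the compass lattice) is EXACTLY the conjunction of the
three registered open stubs of its skeleton `Cruxes/CompassSLE/Lines/birth.lean` — the traversal bound
T1, the `5/8` restriction law I1 and the simplicity of subsequential limits I2b for GM's critical `π/2`
Yang–Baxter walk (through `compassSLE_iff_ybSquareSLE` and `ybSquareSLE_iff_stubs`).
[cite: LawlerSchrammWerner2003Restriction, Thm. 6.1 (p. 23)] -/
theorem compassSLE_iff_stubs :
    SAWCompassLattice.CompassSLE ↔
      ((∀ (D : DobrushinDomain) (a b : ℝ → MidEdge),
        IsYBEndpointApprox (fun (_ : ℤ) => Real.pi / 2) D a b →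
        ∃ (k : ℂ → ℝ → ℝ → ℕ) (K lam δ₀ : ℝ), 0 ≤ K ∧ 2 < lam ∧ 0 < δ₀ ∧
          ∀ δ ∈ Set.Ioc (0 : ℝ) δ₀, ∀ (x : ℂ) (ρ R : ℝ), δ ≤ ρ → ρ < R → R ≤ 1 →
            ybLaw (fun (_ : ℤ) => Real.pi / 2) D.carrier δ 1 (a δ) (b δ)
                {γ | (⟨γ.path (fun (_ : ℤ) => Real.pi / 2) δ⟩ : Curve ℂ).HasTraversals (k x ρ R) x ρ R} ≤
              ENNReal.ofReal (K * (ρ / R) ^ lam)) ∧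
      (∀ (D D' : DobrushinDomain) (a b : ℝ → MidEdge),
        IsYBEndpointApprox (fun (_ : ℤ) => Real.pi / 2) D a b →
        D'.carrier ⊆ D.carrier → D'.pt 0 = D.pt 0 → D'.pt 1 = D.pt 1 →
        (∃ ε : ℝ, 0 < ε ∧ D'.carrier ∩ Metric.ball (D.pt 0) ε = D.carrier ∩ Metric.ball (D.pt 0) ε ∧
          D'.carrier ∩ Metric.ball (D.pt 1) ε = D.carrier ∩ Metric.ball (D.pt 1) ε) →
        ∀ (φ : ConformalEquiv upperHalfPlaneSet D.carrier), D.IsChordalUniformizing φ →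
        ∀ (Φ : ConformalEquiv (upperHalfPlaneSet \ φ.pullbackHull D') upperHalfPlaneSet) (d : ℝ),
          IsRestrictionMap (φ.pullbackHull D') Φ → HasRestrictionDeriv (φ.pullbackHull D') Φ d →
          Tendsto (fun δ => ((ybLaw (fun (_ : ℤ) => Real.pi / 2) D.carrier δ 1 (a δ) (b δ)).map
              (fun γ => γ.curve (fun (_ : ℤ) => Real.pi / 2) δ))
              (CurveClass.rangeSubset (closure D'.carrier)))
            (𝓝[>] (0 : ℝ)) (𝓝 (ENNReal.ofReal (d ^ ((5 : ℝ) / 8))))) ∧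
      (∀ (D : DobrushinDomain) (a b : ℝ → MidEdge),
        IsYBEndpointApprox (fun (_ : ℤ) => Real.pi / 2) D a b →
        ∀ (s : ℕ → ℝ) (ν : Measure (CurveClass ℂ)), Tendsto s atTop (𝓝[>] (0 : ℝ)) →
          IsProbabilityMeasure ν →
          (∀ f : BoundedContinuousFunction (CurveClass ℂ) ℝ,
            Tendsto (fun n => ∫ γ, f (γ.curve (fun (_ : ℤ) => Real.pi / 2) (s n))
                ∂(ybLaw (fun (_ : ℤ) => Real.pi / 2) D.carrier (s n) 1 (a (s n)) (b (s n))))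
              atTop (𝓝 (∫ x, f x ∂ν))) →
          ∀ᵐ γ ∂ν, γ ∈ CurveClass.simple)) :=
  compassSLE_iff_ybSquareSLE.trans ybSquareSLE_iff_stubs

/-! ### The crux follows from the cruxes of route SAWTrackTransport -/

/-- **The five cruxes of route SAWTrackTransport give `YBSquareSLE`.** From `AngleUniversality`
(stmt-16963), `YBLimitExists` (stmt-16995), `AxiomsOfLimit` (stmt-16965), `RStarRot` (stmt-7298) and
`MirrorRotation` (stmt-16997): the robust full limit `P` of the critical square-tiling walk is
similarity covariant (rotations by the reflection trick), restriction–Markov, reversible,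
conjugation covariant and carried by simple boundary-avoiding chords, hence conformally covariant
(`R*_rot`), hence each `P D` is THE chordal SLE(8/3) law (`LawlerSchrammWerner2003_holds`, PROVED);
and the robust limit at `u ≡ 0` is convergence in law of the `π/2` curve laws of every port endpoint
approximation (`YbRelay.tendstoLaw_of_robustLimit`). Port of `SAWTrackTransport.closes` without its
`YBtoUniform` leg. [cite: LawlerSchrammWerner2003Restriction, Thm. 6.1 (p. 23)] -/
theorem ybSquareSLE_of_trackTransport :
    SAWTrackTransport.AngleUniversality → SAWTrackTransport.YBLimitExists →
    SAWTrackTransport.AxiomsOfLimit → SAWTrackTransport.RStarRot → SAWTrackTransport.MirrorRotation →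
    SAWCompassLattice.YBSquareSLE := by
  intro h₂ h₃ h₄ h₅ h₇ D a b hab
  -- endpoint approximations at every angle, and the robust full limit `P` of the square-tiling walk
  obtain ⟨happAll, P, hPch, hconv⟩ := h₃
  have hEnd : ∀ D : DobrushinDomain, ∃ a b : ℝ → MidEdge,
      IsYBEndpointApprox (fun (_ : ℤ) => Real.pi / 2) D a b :=
    fun D => happAll (Real.pi / 2) pi_div_two_mem_Icc D
  -- the axioms of the limit that need no rotation
  obtain ⟨-, hSimOfRot, hRM, hRev, hConj, hSimple⟩ := h₄ P hPch hEnd hconv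
  -- rotation covariance from angle universality (the reflection trick), then similarity covariance
  have hrot := h₇ h₂ happAll P hPch hconv
  have hSim : P.IsSimilarityCovariant := hSimOfRot hrot
  -- rotation-invariant restriction–Markov rigidity: conformal covariance
  have hCC : P.IsConformallyCovariant := h₅ P hPch hRM hRev hSim hConj hSimple
  -- Lawler–Schramm–Werner 2003 (PROVED): `P D` is the chordal SLE(8/3) law
  obtain ⟨Γ, hΓ, hlaw⟩ :=
    LawlerSchrammWerner2003_holds P hPch hCC hRM.isRestriction hSimple D
  -- the robust limit at `u ≡ 0`: convergence in law of the `π/2` curve laws of `(a, b)` to `P D`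
  have hfix := Cruxes.HexTransfer.YbRelay.tendstoLaw_of_robustLimit (Real.pi / 2) P hconv D a b hab
  refine ⟨Γ, hΓ, Eventually.of_forall fun δ =>
    YBWalk.aemeasurable_curve (fun (_ : ℤ) => Real.pi / 2) D.carrier δ 1 (a δ) (b δ), fun f => ?_⟩
  have hlim : ∫ ω, f (Γ ω) ∂Process.preWienerMeasure = ∫ x, f x ∂(P D) := by
    rw [hlaw, integral_map hΓ.aemeasurable f.continuous.aestronglyMeasurable]
  rw [hlim]
  exact hfix f

/-- **The five cruxes of route SAWTrackTransport give the crux `CompassSLE`** (through the landed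
port transfer `compassSLE_iff_ybSquareSLE`): `AngleUniversality → YBLimitExists → AxiomsOfLimit →
RStarRot → MirrorRotation → CompassSLE`. [cite: LawlerSchrammWerner2003Restriction, Thm. 6.1 (p. 23)] -/
theorem compassSLE_of_trackTransport :
    SAWTrackTransport.AngleUniversality → SAWTrackTransport.YBLimitExists →
    SAWTrackTransport.AxiomsOfLimit → SAWTrackTransport.RStarRot → SAWTrackTransport.MirrorRotation →
    SAWCompassLattice.CompassSLE :=
  fun h₂ h₃ h₄ h₅ h₇ => compassSLE_of_ybSquareSLE (ybSquareSLE_of_trackTransport h₂ h₃ h₄ h₅ h₇)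

end Summit.CriticalPhenomena.SAWScalingLimit.Theorems.SAWCompassLatticeCompassSLE

end
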